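import Mathlib
import HarnessLib
import Summits.NavierStokesRegularity.NavierStokesRegularity.Theorems.UnthreadedRigidityDoorUnthreadedRigidityVirialHornCompositions
import Summits.NavierStokesRegularity.NavierStokesRegularity.Theorems.UnthreadedRigidityDoorUnthreadedRigidityVirialHornAngularTwo
import Summits.NavierStokesRegularity.NavierStokesRegularity.Theorems.UnthreadedRigidityDoorUnthreadedRigidityVirialHornDegreeTwo

/-!
# Route `UnthreadedRigidityDoor`, item `UnthreadedRigidity` (W2, stmt-NavierStokesRegularity-27585) — LINE g11-1 «VIRIAL HORN»:
# the DEGREE-TWO RUNGS with every support discharged — only the bridges (and S-U for the window) remain at `l = 2`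

Prover file (W2 Lean hand ns-crc-p1 g7, KEY-NS #188 (1); `--supports stmt-NavierStokesRegularity-27585 --as helper`).  With S-V
(`virialNondegeneracy_holds`), S-Z (`zonalShellAxisym_holds`), S-A (`analyticWedgeSeparableL_holds`) and the degree-two ANGULAR LEMMA
(`angularLemma_two`) landed, the sketch's compositions specialise at `l = 2` with NO support hypothesis left:
`separableOrderTwoRigidity_two_of_identity : OrderTwoVirialIdentity → (the slice rung `SeparableOrderTwoRigidityL` at l = 2)` — the degree-two
separable rung of g11-1 waits only on the bridge V — and
`isotypicWindowRigidity_two_of_bridges : WindowWedgeAnalyticL → VirialWindowSilence → WindowAxisUniform → IsotypicWindowRigidityL 2 n`.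
The proofs are the sketch's compositions with `l := 2` and `angularLemma_two` in place of S-C.  COROLLARY across the two lines:
`separableShellOrderTwoRigidity_of_virialIdentity : OrderTwoVirialIdentity → ProfileHorn.SeparableShellOrderTwoRigidity` — g10-2's rung from g11-1's
bridge V (the degree-two dictionary of `…VirialHornDegreeTwo`), an alternative to PH + THEOREM PHR.

HONEST LABEL: plumbing of a RUNG line about SPECIAL separable/isotypic data; `UnthreadedRigidity` (27585), W2 and NS regularity remain OPEN;
nobody here claims `UnthreadedRigidity`.  0 kit.
-/

-- the summit and its single sub-problem share the name (CONVENTIONS §1), as in every Theorems file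
set_option linter.dupNamespace false

namespace Summit.NavierStokesRegularity.NavierStokesRegularity.Theorems.UnthreadedRigidity.VirialHorn

open scoped Topology
open Filter Set
open Summit.NavierStokesRegularity.NavierStokesRegularity.Theorems.UnthreadedRigidity.ProfileHorn (E3 threadingFlux IsSliceAxisymmetric isSliceAxisymmetric_of_eq_zero
  SeparableShellOrderTwoRigidity)

/-- **THE DEGREE-TWO SEPARABLE RUNG FROM THE BRIDGE V ALONE**: for `l = 2` the slice rung `SeparableOrderTwoRigidityL` holds as soon as the
ORDER-TWO VIRIAL IDENTITY does (S-V, S-C at `l = 2`, S-Z are tree theorems). -/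
theorem separableOrderTwoRigidity_two_of_identity (hV : OrderTwoVirialIdentity) :
    ∀ (t₀ T : ℝ) (u : ℝ → E3 → E3) (p : ℝ → E3 → ℝ) (x₀ : E3) (Y : E3 → ℝ) (H : ℝ → ℝ),
      t₀ < T →
      Literature.Analysis.FluidPDE.IsClassicalNSSolutionOn (Set.Ico t₀ T) 1 0 u p →
      (∀ t ∈ Set.Ico t₀ T, Tendsto (p t) (cocompact E3) (𝓝 0)) →
      IsSolidHarmonic 2 Y → VirialAdmissible 2 H → u t₀ = sepShellL H Y x₀ →
      (∀ x : E3, iteratedDerivWithin 2 (fun t => threadingFlux u x₀ t x) (Set.Ici t₀) t₀ = 0) →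
      IsSliceAxisymmetric (u t₀) x₀ := by
  intro t₀ T u p x₀ Y H hT hsol hp hY hH hu hj2
  have hl : 1 ≤ 2 := by norm_num
  have key := hV 2 t₀ T u p x₀ Y H hl hT hsol hp hY hH hu hj2
  by_cases hm : virialMoment 2 H = 0
  · have hH0 : ∀ r : ℝ, 0 ≤ r → H r = 0 := virialNondegeneracy_holds 2 H hl hH hm
    apply isSliceAxisymmetric_of_eq_zero
    intro x
    rw [hu]
    exact sepShellL_null H Y x₀ hH0 x
  · have hA : ∀ ξ : E3, angForm Y ξ = 0 := fun ξ => (mul_eq_zero.mp (key ξ)).resolve_left hm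
    rw [hu]
    exact zonalShellAxisym_holds 2 H Y x₀ hY (angularLemma_two Y hY hA) hH

/-- **THE DEGREE-TWO ISOTYPIC WINDOW RUNG FROM THE BRIDGES AND S-U**: for `l = 2` the window rung `IsotypicWindowRigidityL 2 n` holds as soon as
the bridges W, V-W and the common-axis support S-U do. -/
theorem isotypicWindowRigidity_two_of_bridges (n : ℕ) (hWA : WindowWedgeAnalyticL) (hVW : VirialWindowSilence) (hU : WindowAxisUniform) :
    IsotypicWindowRigidityL 2 n := by
  intro S hS hconn u x₀ hcont hdiv hmild hbdd hunth hiso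
  have hl : 1 ≤ 2 := by norm_num
  obtain ⟨B, cf, hB, hslice⟩ := hiso
  have hsep : ∀ t ∈ S, ∃ (H : ℝ → ℝ) (Y : E3 → ℝ),
      VirialAdmissible 2 H ∧ IsSolidHarmonic 2 Y ∧ u t = sepShellL H Y x₀ := by
    intro t ht
    obtain ⟨hW, hAn⟩ := hWA 2 n S hl hS u x₀ hcont hdiv hmild hbdd hunth B cf hB hslice t ht
    obtain ⟨H, Y, hH, hY, hHY⟩ := analyticWedgeSeparableL_holds 2 n (cf t) B x₀ (hslice t ht).1 hAn hW
    refine ⟨H, Y, hH, hY, ?_⟩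
    rw [(hslice t ht).2]
    exact hHY
  choose! Hf Yf hHa hYh hHu using hsep
  have key := hVW 2 S hl hS u x₀ hcont hdiv hmild hbdd hunth Hf Yf (fun t ht => ⟨hHa t ht, hYh t ht, hHu t ht⟩)
  have hax : ∀ t ∈ S, IsSliceAxisymmetric (u t) x₀ := by
    intro t ht
    by_cases hm : virialMoment 2 (Hf t) = 0
    · have hH0 : ∀ r : ℝ, 0 ≤ r → Hf t r = 0 := virialNondegeneracy_holds 2 (Hf t) hl (hHa t ht) hm
      apply isSliceAxisymmetric_of_eq_zero
      intro x
      rw [hHu t ht]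
      exact sepShellL_null (Hf t) (Yf t) x₀ hH0 x
    · have hA : ∀ ξ : E3, angForm (Yf t) ξ = 0 := fun ξ => (mul_eq_zero.mp (key t ht ξ)).resolve_left hm
      rw [hHu t ht]
      exact zonalShellAxisym_holds 2 (Hf t) (Yf t) x₀ (hYh t ht) (angularLemma_two (Yf t) (hYh t ht) hA) (hHa t ht)
  exact hU S hS hconn u x₀ hcont hdiv hmild hbdd hax

/-- **g10-2's RUNG FROM g11-1's BRIDGE**: the ORDER-TWO VIRIAL IDENTITY alone implies the PROFILE HORN rung `SeparableShellOrderTwoRigidity`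
(separable `l = 2` shells `Y = Y_Q`, g10-2's admissibility) — through the degree-two dictionary (`sepShell_eq_sepShellL`,
`virialAdmissible_two_of_hornAdmissible`, `isSolidHarmonic_quadY`); an alternative to the route through PH `HornIdentityTwo` + THEOREM PHR. -/
theorem separableShellOrderTwoRigidity_of_virialIdentity (hV : OrderTwoVirialIdentity) : SeparableShellOrderTwoRigidity := by
  intro t₀ T u p x₀ Q H hT hsol hp hQ hH hdat _hj1 hj2
  have hdat' : u t₀ = sepShellL H (ProfileHorn.quadY Q) x₀ := by rw [hdat, sepShell_eq_sepShellL]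
  exact separableOrderTwoRigidity_two_of_identity hV t₀ T u p x₀ (ProfileHorn.quadY Q) H hT hsol hp
    (isSolidHarmonic_quadY hQ) (virialAdmissible_two_of_hornAdmissible hH) hdat' hj2

end Summit.NavierStokesRegularity.NavierStokesRegularity.Theorems.UnthreadedRigidity.VirialHorn
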